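import Mathlib
import Summits.ResolutionOfSingularities.ResolutionOfSingularities.Theorems.WeightedInvariantLocalWeightedDropPolyDescentShiftAlgebra

/-!
# `LocalWeightedDrop`, NC count game — TOT2-LINE piece S-CRV (v1.1 (D)): the CONFLICT (K1) — a tangent graph branch persists at the `u₁`-chart
# origin with contact order ONE LESS (tuple level, every field, every degree)

[OURS · L1 W4.3 · chain w43, engine crux `LocalWeightedDrop` stmt-ResolutionOfSingularities-8899; sub-line under the v32 registered stub
`stub_spaceNCRankDrop`, design memo `L/res-L1-w43-lead-1/g4/TOT2-LINE.md` v1.1 ADDENDUM (D) (res-L1-w43-lead-1), piece S-CRV = res-type-088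
(res-L1-w43-plan-1 DEALS gen 10 #9); `--supports 8899 --as helper`, counted 0; definition-free; nothing here is a statement of any manuscript;
AI-written (gate-accepted = sorry-free with standard axioms, not refereed).]

THE CONFLICT (K1) OF THE ADDENDUM.  In prepared coordinates `(y; u₁, u₂)` of a label `A` (the monic form `y^d + Σ_{j<d} A_j(u₁,u₂) y^j` of
`PolyDescent`), a GRAPH CURVE is `V(ỹ, u₂ + u₁·h(u₁))` (`ỹ = y + ψ(u)`), permissible when `IsPermissibleTwoT d (shift d (shearT h A) ψ)`
(`PolyDescent.HasGraphCurveT`).  It is TANGENT to the boundary plane `V(u₂)` iff `h(0) = 0`, i.e. `h = u₁ · h₁`; its contact order with `V(u₂)`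
is `1 + ord_{u₁}(h)`.  When `V(u₂)` is a boundary letter this is the conflict (K1) and the strategy blows up the POINT.  This file proves the
bookkeeping fact behind «each deviation lowers the contact order by one»:

* `isPermissibleTwoT_blowOneT` — `u₂`-divisibility survives the `u₁`-chart: `IsPermissibleTwoT d B → IsPermissibleTwoT d (blowOneT d B)`;
* `blowOneT_shearT_X_mul` — the `u₁`-chart of the label sheared by `u₁·h₁` is the `u₁`-chart label sheared by `h₁` (slotwise
  `MonicDescent.blowOne_shear`, CJS `v⁽¹⁾ = v/u₁`);
* `coeff_X_zero_eq_zero_of_isPermissibleTwoT_shift` — for a position `B` (`ord B_j > d − j`, `d ≥ 1`) and `ψ(0) = 0`, permissibility of the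
  re-centred tuple `shift d B ψ` along `V(y, u₂)` forces `ψ` to have NO `u₁`-linear term (slot `0` carries `ψ^d + Σ B_j ψ^j`, whose
  `u₁^d`-coefficient is `(∂ψ/∂u₁(0))^d`);
* **`hasGraphCurveT_blowOneT_of_tangent`** — if `(u₁·h₁, ψ)` witnesses a permissible graph curve for the position `A` (tangent case), then
  `(h₁, blowOne 1 ψ)` witnesses one for `blowOneT d A`: the strict transform of the branch passes through the `u₁`-chart origin, is again a
  graph over `u₁`, and its tangency datum dropped from `u₁·h₁` to `h₁`.  (So a branch with `ord h = n` stops conflicting with `V(u₂)` after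
  `n` point blow-ups along it; the (K2) case and the strategy-level count of conflict states are the sequel, on res-L1-w43-lead-1's S-STRAT
  state model.)
-/

set_option linter.dupNamespace false -- mandated namespace of this single-conjunct summit

noncomputable section

namespace Summit.ResolutionOfSingularities.ResolutionOfSingularities.Theorems

namespace TOT2Curve

open MvPowerSeries PolyDescent MonicDescent WildMonic Literature.AlgebraicGeometry.Resolution

variable {k : Type} [Field k] {d : ℕ}

/-! ## `u₂`-divisibility survives the `u₁`-chart -/

/-- `IsPermissibleTwoT` is preserved by `blowOneT` (the `u₁`-chart keeps `u₂`-exponents). -/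
theorem isPermissibleTwoT_blowOneT {B : Fin d → MvPowerSeries (Fin 2) k} (h : IsPermissibleTwoT d B) :
    IsPermissibleTwoT d (blowOneT d B) := by
  intro j e he
  have he' : coeff e (blowOne (d - (j : ℕ)) (B j)) ≠ 0 := he
  rw [coeff_blowOne] at he'
  split_ifs at he' with hle
  · have h1 := h j _ he'
    simpa using h1
  · exact absurd rfl he'

/-! ## The `u₁`-chart of a label sheared by `u₁ h₁` -/

/-- Slotwise `MonicDescent.blowOne_shear`: for `h₁ = h₁(u₁)` and a weak position `A` (`ord A_j ≥ d − j`),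
`blowOneT d (shearT (u₁·h₁) A) = shearT h₁ (blowOneT d A)`. -/
theorem blowOneT_shearT_X_mul (h₁ : MvPowerSeries (Fin 2) k) (hh₁ : ∀ e : Fin 2 →₀ ℕ, e 1 ≠ 0 → coeff e h₁ = 0)
    (A : Fin d → MvPowerSeries (Fin 2) k) (hA : ∀ j : Fin d, ((d - (j : ℕ) : ℕ) : ℕ∞) ≤ (A j).order) :
    blowOneT d (shearT (X 0 * h₁) A) = shearT h₁ (blowOneT d A) := by
  funext j
  exact blowOne_shear _ h₁ (A j) hh₁ (le_sum_of_le_order (hA j))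

/-! ## A permissible re-centring has no `u₁`-linear term -/

/-- Killing `u₂`: the substitution `(u₁, u₂) ↦ (u₁, 0)` keeps exactly the `u₂`-free coefficients. -/
theorem coeff_single_subst_killTwo (F : MvPowerSeries (Fin 2) k) (n : ℕ) :
    coeff (Finsupp.single 0 n) (subst (![X 0, 0] : Fin 2 → MvPowerSeries (Fin 2) k) F) = coeff (Finsupp.single 0 n) F := by
  classical
  have hs : HasSubst (![X 0, 0] : Fin 2 → MvPowerSeries (Fin 2) k) :=
    hasSubst_of_constantCoeff_zero fun i => by fin_cases i <;> simp [constantCoeff_X]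
  rw [coeff_subst hs, finsum_eq_single _ (Finsupp.single 0 n)]
  · rw [Finsupp.prod_single_index (by simp)]
    simp [coeff_X_pow]
  · intro e hne
    by_cases he1 : e 1 = 0
    · have he0 : e 0 ≠ n := by
        intro h0
        apply hne
        ext i
        fin_cases i
        · simpa using h0
        · simpa using he1
      rw [Finsupp.prod_fintype _ _ (fun i => by simp), Fin.prod_univ_two]
      simp only [Matrix.cons_val_zero, Matrix.cons_val_one, he1, pow_zero, mul_one]
      rw [coeff_X_pow, if_neg (fun h => he0 (Finsupp.single_injective _ h).symm), smul_zero]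
    · rw [Finsupp.prod_fintype _ _ (fun i => by simp), Fin.prod_univ_two]
      simp only [Matrix.cons_val_zero, Matrix.cons_val_one, zero_pow he1, mul_zero, map_zero, smul_zero]

/-- **A permissible re-centring has no `u₁`-linear term**: for a position `B` (`ord B_j > d − j`, `d ≥ 1`) and `ψ` with `ψ(0) = 0`, if `V(y, u₂)`
is permissible for the re-centred tuple `shift d B ψ` then `∂ψ/∂u₁(0) = 0`. -/
theorem coeff_X_zero_eq_zero_of_isPermissibleTwoT_shift (hd : 0 < d) {B : Fin d → MvPowerSeries (Fin 2) k} (hB : IsPosT d B)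
    {ψ : MvPowerSeries (Fin 2) k} (hψ : constantCoeff ψ = 0) (hperm : IsPermissibleTwoT d (shift d B ψ)) :
    coeff (Finsupp.single 0 1) ψ = 0 := by
  classical
  -- kill `u₂`: `π F = F(u₁, 0)`
  have hs : HasSubst (![X 0, 0] : Fin 2 → MvPowerSeries (Fin 2) k) :=
    hasSubst_of_constantCoeff_zero fun i => by fin_cases i <;> simp [constantCoeff_X]
  set π : MvPowerSeries (Fin 2) k →ₐ[k] MvPowerSeries (Fin 2) k := substAlgHom hs with hπ
  have hπc : ∀ F n, coeff (Finsupp.single 0 n) (π F) = coeff (Finsupp.single 0 n) F := fun F n => by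
    rw [hπ, coe_substAlgHom]; exact coeff_single_subst_killTwo F n
  -- `π ψ = u₁ · q`
  have hπψ0 : constantCoeff (π ψ) = 0 := by
    rw [← coeff_zero_eq_constantCoeff_apply, ← Finsupp.single_zero (a := (0 : Fin 2)), hπc, Finsupp.single_zero,
      coeff_zero_eq_constantCoeff_apply, hψ]
  have hπψ_noY : ∀ e : Fin 2 →₀ ℕ, e 1 ≠ 0 → coeff e (π ψ) = 0 := by
    intro e he
    rw [hπ, coe_substAlgHom, coeff_subst hs]
    refine finsum_eq_zero_of_forall_eq_zero fun d' => ?_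
    rw [Finsupp.prod_fintype _ _ (fun i => by simp), Fin.prod_univ_two]
    simp only [Matrix.cons_val_zero, Matrix.cons_val_one]
    by_cases hd1 : d' 1 = 0
    · rw [hd1, pow_zero, mul_one, coeff_X_pow, if_neg, smul_zero]
      intro h
      rw [h] at he
      simp at he
    · rw [zero_pow hd1, mul_zero, map_zero, smul_zero]
  have hdvd : X 0 ∣ π ψ := by
    rw [X_dvd_iff]
    intro e he0
    by_cases he1 : e 1 = 0
    · have : e = 0 := by
        ext i; fin_cases i
        · simpa using he0
        · simpa using he1
      rw [this, coeff_zero_eq_constantCoeff_apply, hπψ0]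
    · exact hπψ_noY e he1
  obtain ⟨q, hq⟩ := hdvd
  have hq0 : constantCoeff q = coeff (Finsupp.single 0 1) ψ := by
    rw [← hπc ψ 1, hq, ← coeff_zero_eq_constantCoeff_apply]
    have : coeff (Finsupp.single (0 : Fin 2) 1) (X 0 * q) = coeff (0 + Finsupp.single (0 : Fin 2) 0) q := by
      rw [show (Finsupp.single (0 : Fin 2) 1) = Finsupp.single 0 1 + 0 by rw [add_zero], X, coeff_monomial_mul,
        if_pos (by simp)]
      simp
    rw [this, zero_add, Finsupp.single_zero]
  -- slot `0` of the re-centred tuple, restricted to `u₂ = 0`, has a vanishing `u₁^d`-coefficient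
  let j₀ : Fin d := ⟨0, hd⟩
  have hslot : shift d B ψ j₀ = ψ ^ d + ∑ j : Fin d, B j * ψ ^ (j : ℕ) := by
    rw [shift_eq]
    simp only [j₀, Nat.choose_zero_right, Nat.cast_one, one_mul, Nat.sub_zero]
  have hzero : coeff (Finsupp.single 0 d) (π (shift d B ψ j₀)) = 0 := by
    rw [hπc]
    by_contra hne
    have := hperm j₀ _ hne
    simp [j₀] at this
    omega
  rw [hslot, map_add, map_sum, map_pow] at hzero
  simp only [map_mul, map_pow] at hzero
  -- the `u₁^d`-coefficient of `(π ψ)^d = u₁^d q^d` is `q(0)^d`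
  have hmain : coeff (Finsupp.single 0 d) (π ψ ^ d) = constantCoeff q ^ d := by
    rw [hq, mul_pow, ← map_pow, X_pow_eq, coeff_monomial_mul, if_pos le_rfl, tsub_self, one_mul, coeff_zero_eq_constantCoeff_apply]
  -- the other terms have order `> d` after division by `u₁^j`
  have hrest : coeff (Finsupp.single 0 d) (∑ j : Fin d, π (B j) * π ψ ^ (j : ℕ)) = 0 := by
    rw [map_sum]
    refine Finset.sum_eq_zero fun j _ => ?_
    rw [hq, mul_pow, mul_left_comm, X_pow_eq, coeff_monomial_mul, if_pos, one_mul, ← Finsupp.single_tsub]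
    · apply coeff_of_lt_order
      have hord : ((d - (j : ℕ) : ℕ) : ℕ∞) < (π (B j) * q ^ (j : ℕ)).order := by
        refine lt_of_lt_of_le ?_ le_order_mul
        refine lt_of_lt_of_le (lt_of_lt_of_le (hB j) ?_) le_self_add
        rw [hπ, coe_substAlgHom]
        exact FormalShear.order_le_order_subst' _ (fun i => by fin_cases i <;> simp [constantCoeff_X]) (B j)
      rwa [Finsupp.degree_single]
    · intro i
      by_cases hi : i = 0
      · subst hi; simp only [Finsupp.single_eq_same]; exact j.2.le
      · simp [Ne.symm hi]
  rw [map_add, hmain, hrest, add_zero] at hzero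
  rw [← hq0]
  exact pow_eq_zero_iff (n := d) (by omega) |>.mp hzero

/-! ## The tangent graph branch persists at the `u₁`-chart origin with contact one less -/

/-- **(K1) CONTACT DROP.**  Let `A` be a position, `h₁ = h₁(u₁)` and `ψ(0) = 0`.  If the graph curve `V(y + ψ, u₂ + u₁·(u₁h₁))` is
permissible for `A` (tangent to `V(u₂)`: the conflict (K1) when `V(u₂)` is a boundary letter), then after the point blow-up, at the `u₁`-chart
origin (the point of the strict transform of the branch), the graph curve `V(y + ψ', u₂ + u₁·h₁)` with `ψ' = blowOne 1 ψ` is permissible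
for `blowOneT d A`, and `ψ'(0) = 0`: the same branch, tangency datum `h₁` instead of `u₁h₁` (contact order with `V(u₂)` one less). -/
theorem hasGraphCurveT_blowOneT_of_tangent (hd : 0 < d) (A : Fin d → MvPowerSeries (Fin 2) k) (hA : IsPosT d A)
    (h₁ ψ : MvPowerSeries (Fin 2) k) (hh₁ : ∀ e : Fin 2 →₀ ℕ, e 1 ≠ 0 → coeff e h₁ = 0) (hψ : constantCoeff ψ = 0)
    (hperm : IsPermissibleTwoT d (shift d (shearT (X 0 * h₁) A) ψ)) :
    constantCoeff (blowOne 1 ψ) = 0 ∧ IsPermissibleTwoT d (shift d (shearT h₁ (blowOneT d A)) (blowOne 1 ψ)) := by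
  -- the sheared tuple is again a position
  have hA' : IsPosT d (shearT (X 0 * h₁) A) := fun j =>
    lt_of_lt_of_le (hA j) (by
      show (A j).order ≤ (shear (X 0 * h₁) (A j)).order
      rw [shear_eq]
      exact FormalShear.order_le_order_subst' _ (constantCoeff_shearFamily _) (A j))
  have hψ1 : (1 : ℕ∞) ≤ ψ.order := by
    rw [one_le_order_iff_constCoeff_eq_zero]; exact hψ
  refine ⟨?_, ?_⟩
  · -- `ψ'(0) = ∂ψ/∂u₁(0) = 0`
    rw [← coeff_zero_eq_constantCoeff_apply, coeff_blowOne, if_pos (by simp)]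
    have : Finsupp.single (0 : Fin 2) ((0 : Fin 2 →₀ ℕ) 0 + 1 - (0 : Fin 2 →₀ ℕ) 1) + Finsupp.single 1 ((0 : Fin 2 →₀ ℕ) 1) =
        Finsupp.single 0 1 := by simp
    rw [this]
    exact coeff_X_zero_eq_zero_of_isPermissibleTwoT_shift hd hA' hψ hperm
  · have h1 := isPermissibleTwoT_blowOneT hperm
    rwa [blowOneT_shift _ _ (fun j => (hA' j).le) hψ1, blowOneT_shearT_X_mul h₁ hh₁ A (fun j => (hA j).le)] at h1

end TOT2Curve

end Summit.ResolutionOfSingularities.ResolutionOfSingularities.Theorems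

end
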